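import Summits.Ventures.PercRepro.RankLevelSetRuleQCornerTail
import Summits.Ventures.PercRepro.RankLevelSetRuleQRowOneSmall
import Summits.Ventures.PercRepro.RankLevelSetRuleQCellThree
import Summits.Ventures.PercRepro.RankLevelSetRuleQCellFour
import Summits.Ventures.PercRepro.RankLevelSetRuleQFiveWhole
import Summits.Ventures.PercRepro.RankLevelSetRuleQSixWhole
import Summits.Ventures.PercRepro.RankLevelSetRuleQSevenWhole
import Summits.Ventures.PercRepro.RankLevelSetRuleQEightWhole
import Summits.Ventures.PercRepro.RankLevelSetRuleQNineWhole
import Summits.Ventures.PercRepro.RankLevelSetRuleQTenWhole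

/-!
# PercRepro — THE WHOLE UNTRUNCATED REGIME OF EVERY FAMILY `k ≥ 3` FOR EVERY `q`, UNIFORMLY IN `k`
(p4, gen 29; C-044; paper proofs/P4-CELL-THREE.md §13.12)

**`rhat_whole (q k m) (hk : 3 ≤ k) (hm : m + k ≤ q + 1) : phiK (q+k) q ≤ rhat q k m`** — Rule Q's equal split pays
`Φ(q+k, q)` to every member of every cell `(q+k, q)` with `#P ≤ q − k + 1`, for EVERY `k ≥ 3` and EVERY `q ≥ k − 1`.
For `k ≥ 11` (`rhat_whole_uniform`): `q + 1 ≤ 8k` by the row `J = 1` at the corner (RankLevelSetRuleQRowOneSmall),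
`q ≥ 8k` by the corner through the diagonal chain of the master sum and the small tail (RankLevelSetRuleQCornerChain,
RankLevelSetRuleQCornerTail), both through the reduction of the whole regime to its corner
(RankLevelSetRuleQCornerReduction); for `3 ≤ k ≤ 10` the families of the ladder (`rhatCell_three`, `rhatCell_four`,
`rhat_five_whole`, …, `rhat_ten_whole`).  This closes the uniform-in-`k` statement of §13.6 / §13.8 / §13.11 on the whole
untruncated regime: the window `k² ≲ q < 4k⁴` of RankLevelSetRuleQWholeLargeQ is gone.  Axioms standard.
-/

namespace PercRepro

/-- **THE CORNER OF EVERY FAMILY `k ≥ 11` FOR EVERY `q ≥ k − 1`**: `Φ(q+k, q) ≤ R̂(q, k, q+1−k)`. -/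
theorem rhat_corner_uniform (q k : ℕ) (hk : 11 ≤ k) (hkq : k ≤ q + 1) :
    phiK (q + k) q ≤ rhat q k (q + 1 - k) := by
  rcases le_or_gt (q + 1) (8 * k) with hq | hq
  · exact rhat_whole_of_le_eight_k q k (q + 1 - k) hk hq (by omega)
  · exact rhat_corner_of_eight_k q k (by omega) (by omega)

/-- **THE WHOLE UNTRUNCATED REGIME OF EVERY FAMILY `k ≥ 11` FOR EVERY `q`, UNIFORMLY IN `k`**:
`Φ(q+k, q) ≤ R̂(q, k, m)` for every `m ≤ q + 1 − k`. -/
theorem rhat_whole_uniform (q k m : ℕ) (hk : 11 ≤ k) (hm : m + k ≤ q + 1) :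
    phiK (q + k) q ≤ rhat q k m :=
  rhat_whole_of_corner q k (by omega) (by omega) (rhat_corner_uniform q k hk (by omega)) m hm

/-- **THE WHOLE UNTRUNCATED REGIME OF EVERY FAMILY `k ≥ 3` FOR EVERY `q`**: `Φ(q+k, q) ≤ R̂(q, k, m)` for every
`k ≥ 3` and every `m ≤ q + 1 − k` (the ladder `k ≤ 10` and the uniform theorem `k ≥ 11`). -/
theorem rhat_whole (q k m : ℕ) (hk : 3 ≤ k) (hm : m + k ≤ q + 1) : phiK (q + k) q ≤ rhat q k m := by
  rcases le_or_gt 11 k with h11 | h11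
  · exact rhat_whole_uniform q k m h11 hm
  · interval_cases k
    · exact rhatCell_three q (by omega) m (by omega)
    · exact rhatCell_four q (by omega) m (by omega)
    · exact rhat_five_whole q m (by omega)
    · exact rhat_six_whole q m (by omega)
    · exact rhat_seven_whole q m (by omega)
    · exact rhat_eight_whole q m (by omega)
    · exact rhat_nine_whole q m (by omega)
    · exact rhat_ten_whole q m (by omega)

/-- The corner of every family `k ≥ 3` for every `q ≥ k − 1`. -/
theorem rhat_corner (q k : ℕ) (hk : 3 ≤ k) (hkq : k ≤ q + 1) : phiK (q + k) q ≤ rhat q k (q + 1 - k) :=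
  rhat_whole q k (q + 1 - k) hk (by omega)

/-- The matroid form of `rhat_whole` (the same statement, named for the transfer). -/
theorem ruleQRecv_ge_uniform (q k m : ℕ) (hk : 3 ≤ k) (hm : m + k ≤ q + 1) : phiK (q + k) q ≤ rhat q k m :=
  rhat_whole q k m hk hm

end PercRepro
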